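import Summits.BirchSwinnertonDyer.BirchSwinnertonDyer.Theorems.KimAtThreeDeepUpperPortOfZetaBody
import Summits.BirchSwinnertonDyer.BirchSwinnertonDyer.Theorems.KimAtThreeShallowEqDeepPortNonAdd
import HarnessLib

/-!
# Route `KimAtThreeKolyvagin` (W2): the UNLOCKED Kato–Kurihara port at `3` WITHOUT the row certificate `hbad`
# (rows with a `3`-anomalous bad place INCLUDED) — ★ PK-6₂-u unlocked, at every reduction type at `3`, and on
# the NON-ADDITIVE rows with the value rows discharged (no `9 ∣ N`)

Cell `bsd-addord`, seat `bsd-addord-w2-c4` (gen 8; owner of crux 19599 `ShallowEqDeepOffKatoStratum`, item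
19077 `ShallowEqDeepAtTorsionFree`).  `--supports` 19599.  HONEST FRAMING: theorems only (no definition, no
named fact, no instance, no `sorry`); END THEOREMS WITH DISPLAYED HYPOTHESES; nothing asserted, nothing booked;
19560 / 19599 / 19077 stay OPEN; BSD is not proved by any of this.  Credit: ★ PK-6₂ is n1011's (cell
`b2b-bsdres`, p13 / p02 / p15 / p18); THEOREM D-u (the `hbad`-free witness pair
`KimAtThreeDeepUpperWitnessPair.exists_katoKuriharaWitnessAt_pair_of_zetaBody_of_unramified`) is seat w2-c3's
(gen 5, p471148 / p471352); the unlocking is this seat's gen 7 (p475469).  Proof texts ADAPTED, not edited.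

## What

§1 `katoKuriharaPortUnlocked_zero_of_zetaBody_of_unramified` = gen 7's unlocked ★ PK-6₂
(`KimAtThreeShallowEqDeepPortOfZetaBody.katoKuriharaPortUnlocked_zero_of_zetaBody`) with THEOREM D's `hbad`
DELETED, exactly as w2-c3's `KimAtThreeDeepUpperPortOfZetaBody.katoKuriharaPortThreeAtWith₂_zero_of_zetaBody_of_unramified`
deletes it from the locked ★ PK-6₂: the extra input of THEOREM D-u (every Kato class unramified away from `3` at
class level) is conjunct (C2) of `ZetaBody` itself ([Kato2004Asterisque] (8.1.3); [MazurRubin2004] Remark A.5).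
Displayed: `hbody`, the riders `hfin` (exponent `0`), `hcdA`, `ht0`, the value rows `hvalue`, surj(3), `v₃`; ANY
reduction type at `3`.  §2 `katoKuriharaPortUnlocked_zero_of_zetaBody_nonAdd_of_unramified` = this seat's
`KimAtThreeShallowEqDeepPortNonAdd.katoKuriharaPortUnlocked_zero_of_zetaBody_nonAdd` without `hbad`: the unlocked
port on the NON-ADDITIVE `t = 0` rows (good non-anomalous / supersingular / multiplicative `3 ∤ c₃`) from
`hbody` + R-κ + guards + the NON-ANOMALOUS depletion certificate + the 𝔊⁻ certificate + the (P-EXP) riders at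
exponent `1` + `hcdA` + `ht0` (§1 on the `3`-scaled body `zetaBody_smul 3 hbody`, value rows by
`valueRows_of_zetaBody_mul`).  §3 `portTwoExp_zero_of_zetaBody_nonAdd_of_unramified`: the same in
`KimAtThreeShallowEqDeepPortRows`' two-exponent currency `(t, e) = (0, 0)`.
HONEST LIMITS: `t = 0` only; the riders, R-κ and the level-free certificates stay displayed; good ANOMALOUS `3`
not covered by §2–§3; nothing booked.

References: [Kato2004Asterisque] (8.1.3) p. 180, §9.4, Thm. 9.7 p. 189, Thm. 6.6 (1) p. 163, Ex. 13.3;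
[Kim2022StructureSelmer] Lemma 3.3, Thm. 3.13, §3.3–§3.5; [MazurRubin2004] Def. 3.1.3, Thm. 3.2.4, App. A
(Lemma A.1, Remark A.5); [Rubin2000] Thm. 4.5.1; [Sakamoto2024] §2, Def. 4.1; memo HOME/w2c4/W2C4-PORTSEAM-g7.md §5.
-/

set_option autoImplicit false
-- the Theorems namespace of a single-conjunct summit repeats the summit name by design (D-0017)
set_option linter.dupNamespace false

noncomputable section

open scoped NumberField TensorProduct ContRepresentation Classical
open CategoryTheory Field Function Finset IsDedekindDomain NumberField WeierstrassCurve
open Rat.HeightOneSpectrum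
open Literature.NumberTheory.GaloisRepresentations Literature.NumberTheory.GaloisCohomology
open Literature.NumberTheory.GaloisRepresentations.DiscreteGaloisModule
open Literature.NumberTheory.EllipticCurves Literature.NumberTheory.EllipticCurves.ModularForms
open Literature.NumberTheory.EllipticCurves.Kato2004
open Literature.NumberTheory.EllipticCurves.Kato2004.EulerSystemValues

namespace Summit.BirchSwinnertonDyer.BirchSwinnertonDyer.Theorems.KimAtThreeShallowEqDeepPortNonAddUnramified

open Summit.BirchSwinnertonDyer.Rank1Residual.GaloisImage
open Summit.BirchSwinnertonDyer.BirchSwinnertonDyer.Theorems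
open Summit.BirchSwinnertonDyer.BirchSwinnertonDyer.Theorems.KimAtThreeShallowEqDeepZetaBodyScaling
open Summit.BirchSwinnertonDyer.BirchSwinnertonDyer.Theorems.KimAtThreeShallowEqDeepValueRowsNonAdd
open Summit.BirchSwinnertonDyer.BirchSwinnertonDyer.Theorems.KimAtThreeShallowEqDeepPortNonAdd

variable (W : WeierstrassCurve ℚ) [W.IsElliptic] [W.IsGloballyMinimal]
  [ContinuousSMul ℤ_[3] (W.tateModule 3)] [Module.Free ℤ_[3] (W.tateModule 3)]
  [Module.Finite ℤ_[3] (W.tateModule 3)]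

/-! ### §1 ★ PK-6₂ UNLOCKED WITHOUT `hbad` (any reduction type at `3`; value rows displayed) -/

set_option backward.isDefEq.respectTransparency false in
/-- **★ PK-6₂ unlocked, WITHOUT `hbad`**: the unlocked Kato–Kurihara port at `t = 0` (n1011's one-exponent
witness clauses `KatoKuriharaWitnessAt W · 0 · v₃ P` at two depths + (COMP)) from Kato's witnesses `hbody` for
`P.f` at the conductor level, the riders `hfin` (exponent `0`), `hcdA`, THEOREM D-u's certificate `ht0` at `3`
only, the value rows `hvalue`, surj(3) and the place `v₃` — rows WITH a `3`-anomalous bad place included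
(w2-c3's THEOREM D-u chain: the derivative classes of an Euler system unramified above `w` are `𝓕_u`-valued at
`w`, the unramifiedness being conjunct (C2) of `ZetaBody`).  Proof text = gen 7's unlocked ★ PK-6₂ with
n1011's T-PK62-PAIR replaced by w2-c3's `…WitnessPair.exists_katoKuriharaWitnessAt_pair_of_zetaBody_of_unramified`.
[cite: Kato2004Asterisque, (8.1.3) (p. 180), §9.4 (p. 188), Thm. 9.7 (p. 189) and Ex. 13.3 (pp. 224–225)]
[cite: Kim2022StructureSelmer, Thm. 3.13 and §1.2.2, §2.2.2, §3.3–§3.4.1 (arXiv v3 pp. 12, 17–18, 26–27)]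
[cite: MazurRubin2004, Def. 3.1.3, Thm. 3.2.4 and App. A (Lemma A.1, Remark A.5)] [cite: Sakamoto2024, §2 and Def. 4.1] -/
theorem katoKuriharaPortUnlocked_zero_of_zetaBody_of_unramified
    {N : ℕ} [NeZero N] (P : ModularParametrizationData W N) (hN : N = W.conductorNorm ℤ)
    {ι : (n : ℕ) → (CyclotomicField n ℚ →+* ℂ)} {κK : ℝ}
    {Λ : ∀ (k' : ℕ) (r : Finset (HeightOneSpectrum (𝓞 ℚ))),
      H1 (tateRep W 3) (cycSubgroup 3 k' r) →ₗ[ℤ_[3]] ℚ_[3] ⊗[ℚ] CyclotomicField (cycLevel 3 k' r) ℚ}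
    {c d a : ℤ} {A : ℕ}
    {z : ∀ (k' : ℕ) (r : (cyclotomicLevelsRat 3 (badPlaces c d A N)).Ideals),
      H1 (tateRep W 3) ((cyclotomicLevelsRat 3 (badPlaces c d A N)).level k' r.1)}
    {x : ∀ (k' : ℕ) (r : (cyclotomicLevelsRat 3 (badPlaces c d A N)).Ideals),
      CyclotomicField (cycLevel 3 k' r.1) ℚ}
    (hbody : ZetaBody W 3 P.f ι κK Λ c d a A z x)
    {v₃ : HeightOneSpectrum (𝓞 ℚ)} (hv₃ : ((3 : ℕ) : 𝓞 ℚ) ∈ v₃.asIdeal)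
    (hsurj : W.HasSurjectiveModNGaloisRep ((3 : ℕ) : ℤ))
    (Λfin : ∀ j : ℕ, galoisCohomology ((W.torsionGaloisModule (((3 : ℕ) : ℤ) ^ j * ((3 : ℕ) : ℤ))).toLocal
      (Sum.inr v₃)) 1 →+ ZMod (3 ^ (j + 1)))
    (hfin : ∀ j : ℕ, KatoExpStarFiniteLevelAt W 3 j 0 v₃ Λ (Λfin j))
    {η : (q : HeightOneSpectrum (𝓞 ℚ)) → (ZMod (Ideal.absNorm q.asIdeal))ˣ}
    -- the auxiliary datum avoids every prime `≡ 1 (mod 3)` (so every Kolyvagin prime is usable)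
    (hcdA : ∀ q : ℕ, q.Prime → q ≡ 1 [MOD 3] → ¬ q ∣ 2 * c.natAbs * d.natAbs * A)
    -- THEOREM D-u's row certificate at `3` only (`t = 0`); NO `hbad`
    (ht0 : ∀ w : HeightOneSpectrum (𝓞 ℚ), ((3 : ℕ) : 𝓞 ℚ) ∈ w.asIdeal →
        ∀ Q : (W.baseChange (w.adicCompletion ℚ)).toAffine.Point, 3 • Q = 0 → Q = 0)
    -- the per-level VALUE ROWS (T-PK6-VROW's OUT), displayed
    (hvalue : ∀ (j : ℕ) (σ : HeightOneSpectrum (𝓞 ℚ) → absoluteGaloisGroup ℚ),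
      (∀ q, σ q ∈ (adicCompletionPrime ℚ q).inertia (absoluteGaloisGroup ℚ)) →
      (∀ q, modNCyclotomicCharacter ℚ (Ideal.absNorm q.asIdeal) (σ q) = η q) →
      ∀ (r : Finset (HeightOneSpectrum (𝓞 ℚ)))
        (hr : ∀ q ∈ r, q ∈ (cyclotomicLevelsRat 3 (badPlaces c d A N)).primes),
        (∀ q ∈ r, Kato.IsKolyvaginPrime W 3 (j + 1) ((primesEquiv q : Nat.Primes) : ℕ)) →
        (∀ q ∈ r, Subgroup.zpowers (η q) = ⊤) →
        ∃ (s : ℤ_[3]) (u : (ZMod (3 ^ (j + 1)))ˣ)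
          (ψ : (ℓ : ℕ) → (ZMod ℓ)ˣ →* Multiplicative (ZMod (3 ^ (j + 1)))),
          (∀ q ∈ r, Function.Surjective (ψ (Ideal.absNorm q.asIdeal))) ∧
          (∃ l ∈ cycIntLattice 3 (cycLevel 3 0 r),
            (((3 : ℕ) : ℤ_[3]) ^ (0 : ℕ)) • ((1 : ℚ_[3]) ⊗ₜ[ℚ]
              ((r.noncommProd (fun ℓ : HeightOneSpectrum (𝓞 ℚ) =>
                  ∑ j ∈ Finset.range (((primesEquiv ℓ : Nat.Primes) : ℕ) - 1),
                    (j : Module.End ℚ (CyclotomicField (cycLevel 3 0 r) ℚ)) *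
                      (sigma (cycLevel 3 0 r) (modNCyclotomicCharacter ℚ (cycLevel 3 0 r) (σ ℓ)) :
                        CyclotomicField (cycLevel 3 0 r) ℚ →ₐ[ℚ]
                          CyclotomicField (cycLevel 3 0 r) ℚ).toLinearMap ^ j)
                (ZetaValue.pairwise_commute_fieldDeriv (cycLevel 3 0 r)
                  (fun ℓ => modNCyclotomicCharacter ℚ (cycLevel 3 0 r) (σ ℓ))
                  (fun ℓ => ((primesEquiv ℓ : Nat.Primes) : ℕ) - 1) r))
                (x 0 ⟨r, hr⟩ + sigma (cycLevel 3 0 r) (-1) (x 0 ⟨r, hr⟩)))) -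
              ((s : ℚ_[3]) ⊗ₜ[ℚ] (1 : CyclotomicField (cycLevel 3 0 r) ℚ)) =
            (((3 : ℕ) : ℤ_[3]) ^ (j + 1)) • (l : ℚ_[3] ⊗[ℚ] CyclotomicField (cycLevel 3 0 r) ℚ)) ∧
          haveI : NeZero (∏ q ∈ r, Ideal.absNorm q.asIdeal) :=
            ⟨Finset.prod_ne_zero_iff.2 fun q _ h => q.ne_bot (Ideal.absNorm_eq_zero_iff.1 h)⟩
          PadicInt.toZModPow (j + 1) s = (u : ZMod (3 ^ (j + 1))) *
            ((3 : ℕ) : ZMod (3 ^ (j + 1))) ^ (0 : ℕ) *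
              kuriharaNumber P.f (3 ^ (j + 1)) (∏ q ∈ r, Ideal.absNorm q.asIdeal) ψ) :
    ∀ (k k' : ℕ) (D : KolyvaginDatum (W.torsionGaloisModule (((3 : ℕ) : ℤ) ^ k * ((3 : ℕ) : ℤ))))
      (D' : KolyvaginDatum (W.torsionGaloisModule (((3 : ℕ) : ℤ) ^ k' * ((3 : ℕ) : ℤ))))
      (red : (W.torsionGaloisModule (((3 : ℕ) : ℤ) ^ k' * ((3 : ℕ) : ℤ))).toContRepresentation →ⁱL
        (W.torsionGaloisModule (((3 : ℕ) : ℤ) ^ k * ((3 : ℕ) : ℤ))).toContRepresentation),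
      D.IsCanonicalTauDatumThreeAtWith W k k η → D'.IsCanonicalTauDatumThreeAtWith W k' k' η → k ≤ k' →
      (∀ y : geomTorsion W (((3 : ℕ) : ℤ) ^ k' * ((3 : ℕ) : ℤ)),
        ((red y : geomTorsion W (((3 : ℕ) : ℤ) ^ k * ((3 : ℕ) : ℤ))) : geomPoints W) =
          (((3 : ℕ) : ℤ) ^ (k' - k)) • (y : geomPoints W)) →
      ∃ κ Λ₀ κ' κu Λu κu',
        KatoKuriharaWitnessAt W k 0 D v₃ P κ Λ₀ κ' ∧ KatoKuriharaWitnessAt W k' 0 D' v₃ P κu Λu κu' ∧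
        ∀ e, D'.IsLevel e → D.IsLevel e →
          galoisCohomology.map red 1 (κu e) = κ e ∧ galoisCohomology.map red 1 (κu' e) = κ' e := by
  intro k k' D D' red hDW hDW' hkk' hred
  -- the guards
  obtain ⟨hT, hC, S, τ, hS, hτμ, hτq, hP⟩ := hDW
  obtain ⟨hT', hC', S', τ', hS', hτμ', hτq', hP'⟩ := hDW'
  have hirr : W.HasIrreducibleModPGaloisRep 3 :=
    hasIrreducibleModPGaloisRep_of_hasSurjectiveModNGaloisRep W 3 hsurj
  -- Kolyvagin primes of the right levels (E1-deep on the deep classes of the guards)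
  have hKol : ∀ q ∈ D.primes, Kato.IsKolyvaginPrime W 3 (k + 1) ((primesEquiv q : Nat.Primes) : ℕ) :=
    fun q hq => KolyvaginPrime.isKolyvaginPrime_of_mem_frobeniusClassPrimes_of_le W
      (Nat.le_add_right k 0) (fun v hv => (hS v hv).1) hτμ hτq (hP hq)
  have hKol' : ∀ q ∈ D'.primes, Kato.IsKolyvaginPrime W 3 (k' + 1) ((primesEquiv q : Nat.Primes) : ℕ) :=
    fun q hq => KolyvaginPrime.isKolyvaginPrime_of_mem_frobeniusClassPrimes_of_le W
      (Nat.le_add_right k' 0) (fun v hv => (hS' v hv).1) hτμ' hτq' (hP' hq)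
  -- every Kolyvagin prime is a usable prime of Kato's system for `(c, d, A, N)`
  have husable : ∀ (j : ℕ) (q : HeightOneSpectrum (𝓞 ℚ)),
      Kato.IsKolyvaginPrime W 3 (j + 1) ((primesEquiv q : Nat.Primes) : ℕ) →
        q ∈ (cyclotomicLevelsRat 3 (badPlaces c d A N)).primes := by
    intro j q hq
    have hℓ := hq.prime
    have h13 : ((primesEquiv q : Nat.Primes) : ℕ) ≡ 1 [MOD 3] :=
      hq.modEq_one.of_dvd (dvd_pow_self 3 (Nat.succ_ne_zero j))
    refine (mem_primes_cyclotomicLevelsRat_badPlaces_iff 3 c d A N q).2 ⟨fun hdvd => ?_, hq.ne⟩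
    rcases (Nat.Prime.dvd_mul hℓ).mp hdvd with h | h
    · exact hcdA _ hℓ h13 h
    · apply hq.not_dvd
      rw [← hN]
      exact dvd_mul_of_dvd_left h 3
  have hPr : D.primes ⊆ (cyclotomicLevelsRat 3 (badPlaces c d A N)).primes :=
    fun q hq => husable k q (hKol q hq)
  have hPr' : D'.primes ⊆ (cyclotomicLevelsRat 3 (badPlaces c d A N)).primes :=
    fun q hq => husable k' q (hKol' q hq)
  -- `𝓕_can,3 = ⊤` at every depth (`t = 0`, Mazur–Rubin Lemma A.1 along the reduction tower)
  have htower : ∀ j : ℕ,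
      ∃ redj : (W.torsionGaloisModule (((3 : ℕ) : ℤ) ^ (j + 1) * ((3 : ℕ) : ℤ))).toContRepresentation →ⁱL
          (W.torsionGaloisModule (((3 : ℕ) : ℤ) ^ j * ((3 : ℕ) : ℤ))).toContRepresentation,
        ∀ y : geomTorsion W (((3 : ℕ) : ℤ) ^ (j + 1) * ((3 : ℕ) : ℤ)),
          ((redj y : geomTorsion W (((3 : ℕ) : ℤ) ^ j * ((3 : ℕ) : ℤ))) : geomPoints W) =
            ((3 : ℕ) : ℤ) • (y : geomPoints W) := by
    intro j
    obtain ⟨redj, hredj⟩ := exists_torsionReduction_three W j (j + 1)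
    refine ⟨redj, fun y => ?_⟩
    rw [hredj, Nat.add_sub_cancel_left, pow_one]
  choose redT hredT using htower
  have htop : ∀ (j : ℕ) (w : HeightOneSpectrum (𝓞 ℚ)), ((primesEquiv w : Nat.Primes) : ℕ) = 3 →
      propagatedSelmerStructure W 3 j (Sum.inr w) = ⊤ := by
    intro j w hw
    have hw3 : ((3 : ℕ) : 𝓞 ℚ) ∈ w.asIdeal := KolyvaginPrime.natCast_mem_asIdeal_of_primesEquiv_eq hw
    exact propagatedSelmerStructure_three_eq_top_of_torsion_eq_zero W w hw3 (ht0 w hw3) redT hredT j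
  -- the witness package at the two depths + (COMP) WITHOUT `hbad` (the seat's T-PK62-PAIR-u on
  -- THEOREM D-u), value rows from `hvalue`
  obtain ⟨κf, κu, h₁, h₂, h₃⟩ :=
    KimAtThreeDeepUpperWitnessPair.exists_katoKuriharaWitnessAt_pair_of_zetaBody_of_unramified W P hbody
      hirr hkk' red hred hv₃ (hfin k) (hfin k') D hT D' hT' hC hC' hPr hPr' hKol hKol' (htop k) (htop k')
      (fun σ hI hχ r hr => hvalue k σ hI hχ r (fun q hq => hPr (hr (Finset.mem_coe.2 hq)))
        (fun q hq => hKol q (hr (Finset.mem_coe.2 hq)))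
        (fun q hq => hC.zpowers_eq_top (hr (Finset.mem_coe.2 hq))))
      (fun σ hI hχ r hr => hvalue k' σ hI hχ r (fun q hq => hPr' (hr (Finset.mem_coe.2 hq)))
        (fun q hq => hKol' q (hr (Finset.mem_coe.2 hq)))
        (fun q hq => hC'.zpowers_eq_top (hr (Finset.mem_coe.2 hq))))
  exact ⟨κf, Λfin k, κf, κu, Λfin k', κu, h₁, h₂, fun e he' he => ⟨h₃ e he' he, h₃ e he' he⟩⟩


/-! ### §2 The unlocked port on the NON-ADDITIVE rows, value rows discharged, WITHOUT `hbad` -/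

set_option backward.isDefEq.respectTransparency false in
/-- **★ PK-6₂ unlocked on the NON-ADDITIVE `t = 0` rows WITHOUT `hbad`, value rows DISCHARGED without
`9 ∣ N`**: the unlocked port from `hbody : ZetaBody W 3 P.f …` at the conductor level, R-κ (b), END-m1's
level-free guards, the NON-ANOMALOUS depletion certificate `v₃(3·∏_{q∣3A}(1 − a_q/q + 𝟙_{q∤N}/q)) = 0`
(its `q = 3` factor is `4 − a₃ = #Ẽ(𝔽₃)` at a good `3`, `3 ∓ 1` at a multiplicative `3`), the 𝔊⁻ certificate,
surj(3), `v₃ ∣ 3`, the (P-EXP) riders AT EXPONENT `1` (lattice `3⁻¹ℤ₃`: good non-anomalous / supersingular /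
multiplicative `3 ∤ c₃`), `hcdA` and `ht0` — §1 on the `3`-scaled body `zetaBody_smul 3 hbody`, riders by
`katoExpStarFiniteLevelAt_smul`, value rows by `valueRows_of_zetaBody_mul`.  Nothing asserted; nothing booked.
[cite: Kato2004Asterisque, §9.4 (p. 188), Thm. 9.7 (p. 189), §6.2 (p. 161), Thm. 6.6 (1) (p. 163) and Ex. 13.3 (pp. 224–225)]
[cite: Kim2022StructureSelmer, Lemma 3.3, Thm. 3.13 and §3.3–§3.5 (arXiv v3 pp. 17–18, 26–28)]
[cite: MazurRubin2004, Def. 3.1.3, Thm. 3.2.4 and App. A (Lemma A.1, Remark A.5)] [cite: Sakamoto2024, §2 and Def. 4.1] -/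
theorem katoKuriharaPortUnlocked_zero_of_zetaBody_nonAdd_of_unramified
    {N : ℕ} [NeZero N] (P : ModularParametrizationData W N) (hN : N = W.conductorNorm ℤ)
    {ι : (n : ℕ) → (CyclotomicField n ℚ →+* ℂ)} {κK : ℝ}
    {Λ : ∀ (k' : ℕ) (r : Finset (HeightOneSpectrum (𝓞 ℚ))),
      H1 (tateRep W 3) (cycSubgroup 3 k' r) →ₗ[ℤ_[3]] ℚ_[3] ⊗[ℚ] CyclotomicField (cycLevel 3 k' r) ℚ}
    {c d a : ℤ} {A : ℕ} [NeZero A]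
    {z : ∀ (k' : ℕ) (r : (cyclotomicLevelsRat 3 (badPlaces c d A N)).Ideals),
      H1 (tateRep W 3) ((cyclotomicLevelsRat 3 (badPlaces c d A N)).level k' r.1)}
    {x : ∀ (k' : ℕ) (r : (cyclotomicLevelsRat 3 (badPlaces c d A N)).Ideals),
      CyclotomicField (cycLevel 3 k' r.1) ℚ}
    (hbody : ZetaBody W 3 P.f ι κK Λ c d a A z x)
    -- R-κ (b) and END-m1's level-free guards
    (hNorm : ∃ u : ℚ, (u : ℝ) = κK ∧ padicValRat 3 u = 0) (hκ0 : κK ≠ 0)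
    (d' : ℤ) (hcd : Int.gcd (c * d) A = 1) (hdd' : d * d' ≡ 1 [ZMOD (A : ℤ)]) (hAN : Nat.Coprime A N)
    (aM : ℕ → ℤ) (haM : ∀ q ∈ (3 * A).primeFactors, cuspCoeff P.f q = aM q)
    -- the NON-ANOMALOUS depletion certificate (`q = 3` factor: `4 − a₃` good / `3 ∓ 1` multiplicative)
    (hE0 : ∏ q ∈ (3 * A).primeFactors, (1 - (aM q : ℚ) / q + (if q ∣ N then 0 else (1 / q : ℚ))) ≠ 0)
    (hE : padicValRat 3 ((3 : ℚ) *
      ∏ q ∈ (3 * A).primeFactors, (1 - (aM q : ℚ) / q + (if q ∣ N then 0 else (1 / q : ℚ)))) = 0)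
    -- the 𝔊⁻ certificate
    (hR0 : (c : ℚ) ^ 2 * (d : ℚ) ^ 2 * ratMinusSymbol P.f ((a : ℚ) / A) -
        (c : ℚ) * (d : ℚ) ^ 2 * ratMinusSymbol P.f ((a * c : ℚ) / A) -
        (c : ℚ) ^ 2 * (d : ℚ) * ratMinusSymbol P.f ((a * d' : ℚ) / A) +
        (c : ℚ) * (d : ℚ) * ratMinusSymbol P.f ((a * c * d' : ℚ) / A) ≠ 0)
    (hR : padicValRat 3 ((c : ℚ) ^ 2 * (d : ℚ) ^ 2 * ratMinusSymbol P.f ((a : ℚ) / A) -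
        (c : ℚ) * (d : ℚ) ^ 2 * ratMinusSymbol P.f ((a * c : ℚ) / A) -
        (c : ℚ) ^ 2 * (d : ℚ) * ratMinusSymbol P.f ((a * d' : ℚ) / A) +
        (c : ℚ) * (d : ℚ) * ratMinusSymbol P.f ((a * c * d' : ℚ) / A)) = 0)
    {v₃ : HeightOneSpectrum (𝓞 ℚ)} (hv₃ : ((3 : ℕ) : 𝓞 ℚ) ∈ v₃.asIdeal)
    (hsurj : W.HasSurjectiveModNGaloisRep ((3 : ℕ) : ℤ))
    -- the (P-EXP) riders AT EXPONENT `1` (lattice `3⁻¹ℤ₃`: good non-anomalous / supersingular / multiplicative `3`)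
    (Λfin : ∀ j : ℕ, galoisCohomology ((W.torsionGaloisModule (((3 : ℕ) : ℤ) ^ j * ((3 : ℕ) : ℤ))).toLocal
      (Sum.inr v₃)) 1 →+ ZMod (3 ^ (j + 1)))
    (hfin : ∀ j : ℕ, KatoExpStarFiniteLevelAt W 3 j 1 v₃ Λ (Λfin j))
    {η : (q : HeightOneSpectrum (𝓞 ℚ)) → (ZMod (Ideal.absNorm q.asIdeal))ˣ}
    (hcdA : ∀ q : ℕ, q.Prime → q ≡ 1 [MOD 3] → ¬ q ∣ 2 * c.natAbs * d.natAbs * A)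
    -- THEOREM D-u's row certificate at `3` only (`t = 0`); NO `hbad`
    (ht0 : ∀ w : HeightOneSpectrum (𝓞 ℚ), ((3 : ℕ) : 𝓞 ℚ) ∈ w.asIdeal →
        ∀ Q : (W.baseChange (w.adicCompletion ℚ)).toAffine.Point, 3 • Q = 0 → Q = 0) :
    ∀ (k k' : ℕ) (D : KolyvaginDatum (W.torsionGaloisModule (((3 : ℕ) : ℤ) ^ k * ((3 : ℕ) : ℤ))))
      (D' : KolyvaginDatum (W.torsionGaloisModule (((3 : ℕ) : ℤ) ^ k' * ((3 : ℕ) : ℤ))))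
      (red : (W.torsionGaloisModule (((3 : ℕ) : ℤ) ^ k' * ((3 : ℕ) : ℤ))).toContRepresentation →ⁱL
        (W.torsionGaloisModule (((3 : ℕ) : ℤ) ^ k * ((3 : ℕ) : ℤ))).toContRepresentation),
      D.IsCanonicalTauDatumThreeAtWith W k k η → D'.IsCanonicalTauDatumThreeAtWith W k' k' η → k ≤ k' →
      (∀ y : geomTorsion W (((3 : ℕ) : ℤ) ^ k' * ((3 : ℕ) : ℤ)),
        ((red y : geomTorsion W (((3 : ℕ) : ℤ) ^ k * ((3 : ℕ) : ℤ))) : geomPoints W) =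
          (((3 : ℕ) : ℤ) ^ (k' - k)) • (y : geomPoints W)) →
      ∃ κ Λ₀ κ' κu Λu κu',
        KatoKuriharaWitnessAt W k 0 D v₃ P κ Λ₀ κ' ∧ KatoKuriharaWitnessAt W k' 0 D' v₃ P κu Λu κu' ∧
        ∀ e, D'.IsLevel e → D.IsLevel e →
          galoisCohomology.map red 1 (κu e) = κ e ∧ galoisCohomology.map red 1 (κu' e) = κ' e :=
  katoKuriharaPortUnlocked_zero_of_zetaBody_of_unramified W P hN (zetaBody_smul 3 hbody) hv₃ hsurj Λfin
    (fun j => katoExpStarFiniteLevelAt_smul (hfin j)) hcdA ht0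
    (valueRows_of_zetaBody_mul hbody P.isNewformOf (by decide)
      (hasIrreducibleModPGaloisRep_of_hasSurjectiveModNGaloisRep W 3 hsurj) hNorm hκ0 d' hcd hdd' hAN
      aM haM hE0 hE hR0 hR η)

/-! ### §3 The same in `KimAtThreeShallowEqDeepPortRows`' two-exponent currency -/

/-- **The `hbad`-free unlocked port on the non-additive rows in PortRows' currency** (`(t, e) = (0, 0)`):
§2 composed with `KimAtThreeKolyvaginDefs.katoKuriharaWitnessAtTwoExp_zero_of_witnessAt`.
[cite: Kim2022StructureSelmer, Thm. 3.13 (arXiv v3 p. 17)] [cite: Kato2004Asterisque, Thm. 9.7 (p. 189)] -/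
theorem portTwoExp_zero_of_zetaBody_nonAdd_of_unramified
    {N : ℕ} [NeZero N] (P : ModularParametrizationData W N) (hN : N = W.conductorNorm ℤ)
    {ι : (n : ℕ) → (CyclotomicField n ℚ →+* ℂ)} {κK : ℝ}
    {Λ : ∀ (k' : ℕ) (r : Finset (HeightOneSpectrum (𝓞 ℚ))),
      H1 (tateRep W 3) (cycSubgroup 3 k' r) →ₗ[ℤ_[3]] ℚ_[3] ⊗[ℚ] CyclotomicField (cycLevel 3 k' r) ℚ}
    {c d a : ℤ} {A : ℕ} [NeZero A]
    {z : ∀ (k' : ℕ) (r : (cyclotomicLevelsRat 3 (badPlaces c d A N)).Ideals),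
      H1 (tateRep W 3) ((cyclotomicLevelsRat 3 (badPlaces c d A N)).level k' r.1)}
    {x : ∀ (k' : ℕ) (r : (cyclotomicLevelsRat 3 (badPlaces c d A N)).Ideals),
      CyclotomicField (cycLevel 3 k' r.1) ℚ}
    (hbody : ZetaBody W 3 P.f ι κK Λ c d a A z x)
    (hNorm : ∃ u : ℚ, (u : ℝ) = κK ∧ padicValRat 3 u = 0) (hκ0 : κK ≠ 0)
    (d' : ℤ) (hcd : Int.gcd (c * d) A = 1) (hdd' : d * d' ≡ 1 [ZMOD (A : ℤ)]) (hAN : Nat.Coprime A N)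
    (aM : ℕ → ℤ) (haM : ∀ q ∈ (3 * A).primeFactors, cuspCoeff P.f q = aM q)
    (hE0 : ∏ q ∈ (3 * A).primeFactors, (1 - (aM q : ℚ) / q + (if q ∣ N then 0 else (1 / q : ℚ))) ≠ 0)
    (hE : padicValRat 3 ((3 : ℚ) *
      ∏ q ∈ (3 * A).primeFactors, (1 - (aM q : ℚ) / q + (if q ∣ N then 0 else (1 / q : ℚ)))) = 0)
    (hR0 : (c : ℚ) ^ 2 * (d : ℚ) ^ 2 * ratMinusSymbol P.f ((a : ℚ) / A) -
        (c : ℚ) * (d : ℚ) ^ 2 * ratMinusSymbol P.f ((a * c : ℚ) / A) -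
        (c : ℚ) ^ 2 * (d : ℚ) * ratMinusSymbol P.f ((a * d' : ℚ) / A) +
        (c : ℚ) * (d : ℚ) * ratMinusSymbol P.f ((a * c * d' : ℚ) / A) ≠ 0)
    (hR : padicValRat 3 ((c : ℚ) ^ 2 * (d : ℚ) ^ 2 * ratMinusSymbol P.f ((a : ℚ) / A) -
        (c : ℚ) * (d : ℚ) ^ 2 * ratMinusSymbol P.f ((a * c : ℚ) / A) -
        (c : ℚ) ^ 2 * (d : ℚ) * ratMinusSymbol P.f ((a * d' : ℚ) / A) +
        (c : ℚ) * (d : ℚ) * ratMinusSymbol P.f ((a * c * d' : ℚ) / A)) = 0)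
    {v₃ : HeightOneSpectrum (𝓞 ℚ)} (hv₃ : ((3 : ℕ) : 𝓞 ℚ) ∈ v₃.asIdeal)
    (hsurj : W.HasSurjectiveModNGaloisRep ((3 : ℕ) : ℤ))
    (Λfin : ∀ j : ℕ, galoisCohomology ((W.torsionGaloisModule (((3 : ℕ) : ℤ) ^ j * ((3 : ℕ) : ℤ))).toLocal
      (Sum.inr v₃)) 1 →+ ZMod (3 ^ (j + 1)))
    (hfin : ∀ j : ℕ, KatoExpStarFiniteLevelAt W 3 j 1 v₃ Λ (Λfin j))
    {η : (q : HeightOneSpectrum (𝓞 ℚ)) → (ZMod (Ideal.absNorm q.asIdeal))ˣ}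
    (hcdA : ∀ q : ℕ, q.Prime → q ≡ 1 [MOD 3] → ¬ q ∣ 2 * c.natAbs * d.natAbs * A)
    (ht0 : ∀ w : HeightOneSpectrum (𝓞 ℚ), ((3 : ℕ) : 𝓞 ℚ) ∈ w.asIdeal →
        ∀ Q : (W.baseChange (w.adicCompletion ℚ)).toAffine.Point, 3 • Q = 0 → Q = 0) :
    ∀ (k k' : ℕ) (Dk : KolyvaginDatum (W.torsionGaloisModule (((3 : ℕ) : ℤ) ^ k * ((3 : ℕ) : ℤ))))
      (Dk' : KolyvaginDatum (W.torsionGaloisModule (((3 : ℕ) : ℤ) ^ k' * ((3 : ℕ) : ℤ))))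
      (red : (W.torsionGaloisModule (((3 : ℕ) : ℤ) ^ k' * ((3 : ℕ) : ℤ))).toContRepresentation →ⁱL
        (W.torsionGaloisModule (((3 : ℕ) : ℤ) ^ k * ((3 : ℕ) : ℤ))).toContRepresentation),
      Dk.IsCanonicalTauDatumThreeAtWith W k k η → Dk'.IsCanonicalTauDatumThreeAtWith W k' k' η → k ≤ k' →
      (∀ y : geomTorsion W (((3 : ℕ) : ℤ) ^ k' * ((3 : ℕ) : ℤ)),
        ((red y : geomTorsion W (((3 : ℕ) : ℤ) ^ k * ((3 : ℕ) : ℤ))) : geomPoints W) =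
          (((3 : ℕ) : ℤ) ^ (k' - k)) • (y : geomPoints W)) →
      ∃ κ Λ₀ κ' κu Λu κu',
        KimAtThreeKolyvaginDefs.KatoKuriharaWitnessAtTwoExp W k 0 0 Dk v₃ P κ Λ₀ κ' ∧
        KimAtThreeKolyvaginDefs.KatoKuriharaWitnessAtTwoExp W k' 0 0 Dk' v₃ P κu Λu κu' ∧
        ∀ e, Dk'.IsLevel e → Dk.IsLevel e →
          galoisCohomology.map red 1 (κu e) = κ e ∧ galoisCohomology.map red 1 (κu' e) = κ' e := by
  intro k k' Dk Dk' red hDk hDk' hk hred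
  obtain ⟨κ, Λ₀, κ', κu, Λu, κu', hW, hW', hcomp⟩ :=
    katoKuriharaPortUnlocked_zero_of_zetaBody_nonAdd_of_unramified W P hN hbody hNorm hκ0 d' hcd hdd' hAN aM
      haM hE0 hE hR0 hR hv₃ hsurj Λfin hfin hcdA ht0 k k' Dk Dk' red hDk hDk' hk hred
  exact ⟨κ, Λ₀, κ', κu, Λu, κu', KimAtThreeKolyvaginDefs.katoKuriharaWitnessAtTwoExp_zero_of_witnessAt hW,
    KimAtThreeKolyvaginDefs.katoKuriharaWitnessAtTwoExp_zero_of_witnessAt hW', hcomp⟩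

end Summit.BirchSwinnertonDyer.BirchSwinnertonDyer.Theorems.KimAtThreeShallowEqDeepPortNonAddUnramified

end
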